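import Literature.MathematicalPhysics.QuantumLattice.FermionSmearedPauliBound
import HarnessLib

/-!
# Ventures/CertifiedManyBodySolver — Transport/PauliMarkovLetters.lean

HONEST FRAMING: first certified bounds; not a superconductivity verdict; every number certified or labelled float.

Operator-algebra half of LEMMA PMP (matrix Pauli–Markov body; op-02 `HOME/op/PM-2D.md` §7.4; the state
half is `Transport/PauliMarkovMatrix.lean`). In the local CAR algebras `𝔄_Λ = FermionOp Λ` of the tree
(Jordan–Wigner model) fix a spin `σ` and the opposite spin `τ ≠ σ` and the two one-site LETTERS

  `A₀(x) = c_{xσ}`,  `A₁(x) = n_{xτ} c_{xσ}`   (`letterOp`).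

* §1–§2: the CAR bookkeeping `n_a† = n_a`, `n_a² = n_a`, `[n_a, c_p] = [n_a, c†_p] = 0` (`p ≠ a`),
  `[n_a, n_b] = 0`, and **the four operator identities of PM-2D.md §7.4 (G2)**
  `A_j(x) A_l(y)† + A_l(y)† A_j(x) = δ_{xy} K_{jl}(x)`, `K(x) = [𝟙 n_{xτ}; n_{xτ} n_{xτ}]`
  (`letterOp_mul_conjTranspose_add`, `letterGram`; op-02 checked them by exact CAR algebra on the 3×3
  torus, here they are proved for every region), isotony and translation covariance of the letters;
* §3: for a SMEARED LETTER `B(g) = Σ_i Σ_j g_{ij} A_j(x_i)` over distinct sites `x_i`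
  (`smearedLetter`) the **Gram identity** `B B† + B† B = Σ_i Σ_{j,l} g_{ij} ḡ_{il} K_{jl}(x_i)`
  (`smearedLetter_mul_conjTranspose_add`) — the two-letter generalisation of the CAR norm identity
  `a(f)a(f)† + a(f)†a(f) = ‖f‖² 𝟙` of `FermionSmearedPauliBound.lean` (Bratteli–Robinson II §5.2.2).

Finite-dimensional matrix algebra only; no states, no physical notion (abbreviations `letterPrefix`,
`letterOp`, `letterGram`, `smearedLetter`), no named fact, no sorry.

References: op-02 PM-2D.md §7.4 (G1)–(G2); O. Bratteli, D. W. Robinson, *OAQSM II* §5.2.2 (CAR);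
F. H. L. Essler et al., *The One-Dimensional Hubbard Model* (CUP 2005) §2.1 eqs. (2.2), (2.8).
-/

noncomputable section

namespace Summit.Ventures.CertifiedManyBodySolver.Transport

open Matrix Finset MeasureTheory
open Literature.Probability.LatticeModels
open Literature.MathematicalPhysics.QuantumLattice HubbardWave0
open scoped ComplexOrder Real

variable {d : ℕ}

/-! ### §1. `n_a` is Hermitian -/

section CAR

variable {ι : Type*} [LinearOrder ι] [Fintype ι]

/-- `n_a = c†_a c_a` is Hermitian. -/
theorem number_conjTranspose (a : ι) :
    (creation a * annihilation a)ᴴ = creation a * annihilation a := by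
  rw [Matrix.conjTranspose_mul, annihilation_conjTranspose, creation_conjTranspose]

end CAR

/-! ### §2. The two letters `c_{xσ}`, `n_{xτ} c_{xσ}` and their anticommutator table -/

section Letters

variable {Λ : Finset (Site d)}

/-- Two ordered sites of a region are equal iff the underlying sites are. -/
theorem pt_eq_pt_iff {x y : Site d} (hx : x ∈ Λ) (hy : y ∈ Λ) :
    PolySite.pt x hx = PolySite.pt y hy ↔ x = y := by
  constructor
  · intro h
    have := congrArg (fun p : PolySite Λ => ofLex p.1) h
    simpa using this
  · rintro rfl
    rfl

/-- The letter prefix: `P₀(x) = 𝟙`, `P₁(x) = n_{xτ}`. -/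
def letterPrefix (j : Fin 2) (x : Site d) (hx : x ∈ Λ) (τ : Fin 2) : FermionOp Λ :=
  if j = 0 then 1 else nAt x hx τ

/-- **The two letters** `A₀(x) = c_{xσ}`, `A₁(x) = n_{xτ} c_{xσ}` of the PMP body (PM-2D.md §7.4). -/
def letterOp (j : Fin 2) (x : Site d) (hx : x ∈ Λ) (σ τ : Fin 2) : FermionOp Λ :=
  letterPrefix j x hx τ * cAt x hx σ

/-- **The anticommutator table** `K_{jl}(x) = {A_j(x), A_l(x)†}`: `K₀₀ = 𝟙`, otherwise `n_{xτ}`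
(PM-2D.md §7.4 (G2): `{c,c†} = 1`, `{c, b†} = {b, c†} = {b, b†} = n_{−σ}`). -/
def letterGram (j l : Fin 2) (x : Site d) (hx : x ∈ Λ) (τ : Fin 2) : FermionOp Λ :=
  if j = 0 ∧ l = 0 then 1 else nAt x hx τ

/-- `A₀(x) = c_{xσ}`. -/
@[simp] theorem letterOp_zero (x : Site d) (hx : x ∈ Λ) (σ τ : Fin 2) : letterOp 0 x hx σ τ = cAt x hx σ := by
  simp [letterOp, letterPrefix]

/-- `A₁(x) = n_{xτ} c_{xσ}`. -/
@[simp] theorem letterOp_one (x : Site d) (hx : x ∈ Λ) (σ τ : Fin 2) :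
    letterOp 1 x hx σ τ = nAt x hx τ * cAt x hx σ := by
  simp [letterOp, letterPrefix]

/-- `n_{xτ}` is Hermitian. -/
theorem nAt_conjTranspose (x : Site d) (hx : x ∈ Λ) (τ : Fin 2) : (nAt x hx τ)ᴴ = nAt x hx τ :=
  number_conjTranspose _

/-- `n_{xτ}² = n_{xτ}` (the tree's `numberAt_idempotent`). -/
theorem nAt_mul_self (x : Site d) (hx : x ∈ Λ) (τ : Fin 2) : nAt x hx τ * nAt x hx τ = nAt x hx τ :=
  (numberAt_idempotent _).eq

/-- `n_{xτ} n_{yτ} = n_{yτ} n_{xτ}` (the tree's `numberAt_commute`). -/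
theorem nAt_comm (x y : Site d) (hx : x ∈ Λ) (hy : y ∈ Λ) (τ : Fin 2) :
    nAt x hx τ * nAt y hy τ = nAt y hy τ * nAt x hx τ :=
  (numberAt_commute _ _).eq

/-- `n_{zτ} c†_{xσ} = c†_{xσ} n_{zτ}` for `τ ≠ σ` (different orbitals; the tree's `number_mul_creation_of_ne`). -/
theorem nAt_mul_cAt_conjTranspose {σ τ : Fin 2} (hστ : σ ≠ τ) (z x : Site d) (hz : z ∈ Λ) (hx : x ∈ Λ) :
    nAt z hz τ * (cAt x hx σ)ᴴ = (cAt x hx σ)ᴴ * nAt z hz τ := by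
  rw [cAt, annihilation_conjTranspose]
  refine number_mul_creation_of_ne fun h => hστ ?_
  exact ((orb_eq_orb_iff.1 h).2).symm

/-- `n_{zτ} c_{xσ} = c_{xσ} n_{zτ}` for `τ ≠ σ` (adjoint of the previous identity). -/
theorem nAt_mul_cAt {σ τ : Fin 2} (hστ : σ ≠ τ) (z x : Site d) (hz : z ∈ Λ) (hx : x ∈ Λ) :
    nAt z hz τ * cAt x hx σ = cAt x hx σ * nAt z hz τ := by
  have h1 := congrArg Matrix.conjTranspose (nAt_mul_cAt_conjTranspose hστ z x hz hx)
  simp only [Matrix.conjTranspose_mul, Matrix.conjTranspose_conjTranspose, nAt_conjTranspose] at h1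
  exact h1.symm

/-- The site CAR: `c_{xσ} c†_{yσ} + c†_{yσ} c_{xσ} = δ_{xy} 𝟙`. -/
theorem cAt_mul_conjTranspose_add (σ : Fin 2) {x y : Site d} (hx : x ∈ Λ) (hy : y ∈ Λ) :
    cAt x hx σ * (cAt y hy σ)ᴴ + (cAt y hy σ)ᴴ * cAt x hx σ = if x = y then (1 : FermionOp Λ) else 0 := by
  rw [cAt, cAt, annihilation_conjTranspose, annihilation_mul_creation_add_creation_mul_annihilation_holds]
  by_cases hxy : x = y
  · subst hxy; simp
  · rw [if_neg hxy, if_neg]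
    intro h
    exact hxy ((pt_eq_pt_iff hx hy).1 (orb_eq_orb_iff.1 h).1)

/-- **The four CAR identities of the PMP letters** (PM-2D.md §7.4 (G2)):
`A_j(x) A_l(y)† + A_l(y)† A_j(x) = δ_{xy} K_{jl}(x)`. -/
theorem letterOp_mul_conjTranspose_add {σ τ : Fin 2} (hστ : σ ≠ τ) (j l : Fin 2) {x y : Site d}
    (hx : x ∈ Λ) (hy : y ∈ Λ) :
    letterOp j x hx σ τ * (letterOp l y hy σ τ)ᴴ + (letterOp l y hy σ τ)ᴴ * letterOp j x hx σ τ =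
      if x = y then letterGram j l x hx τ else 0 := by
  have hcc := cAt_mul_conjTranspose_add σ hx hy
  fin_cases j <;> fin_cases l
  all_goals simp only [Fin.zero_eta, Fin.mk_one, Fin.isValue]
  · -- (0,0): `{c_x, c_y†}`
    simpa [letterGram] using hcc
  · -- (0,1): `{c_x, c_y† n_y} = {c_x, c_y†} n_y`
    simp only [letterOp_zero, letterOp_one, letterGram, Fin.isValue, one_ne_zero, and_false, if_false,
      Matrix.conjTranspose_mul, nAt_conjTranspose]
    rw [mul_assoc, nAt_mul_cAt hστ, ← mul_assoc, ← mul_assoc, ← add_mul, hcc]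
    split_ifs with h
    · subst h; rw [one_mul]
    · rw [zero_mul]
  · -- (1,0): `{n_x c_x, c_y†} = n_x {c_x, c_y†}`
    simp only [letterOp_zero, letterOp_one, letterGram, Fin.isValue, one_ne_zero, false_and, if_false]
    rw [← mul_assoc, ← nAt_mul_cAt_conjTranspose hστ, mul_assoc, mul_assoc, ← mul_add, hcc]
    split_ifs with h
    · rw [mul_one]
    · rw [mul_zero]
  · -- (1,1): `{n_x c_x, c_y† n_y} = n_x n_y {c_x, c_y†}`
    simp only [letterOp_one, letterGram, Fin.isValue, one_ne_zero, and_false, if_false,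
      Matrix.conjTranspose_mul, nAt_conjTranspose]
    -- `n_x c_x (c_y† n_y) = n_x n_y (c_x c_y†)` and `c_y† n_y (n_x c_x) = n_x n_y (c_y† c_x)`
    have h1 : nAt x hx τ * cAt x hx σ * ((cAt y hy σ)ᴴ * nAt y hy τ) =
        nAt x hx τ * nAt y hy τ * (cAt x hx σ * (cAt y hy σ)ᴴ) := by
      rw [← nAt_mul_cAt_conjTranspose hστ y y hy hy, ← mul_assoc (nAt x hx τ * cAt x hx σ),
        mul_assoc (nAt x hx τ) (cAt x hx σ) (nAt y hy τ), ← nAt_mul_cAt hστ y x hy hx,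
        ← mul_assoc (nAt x hx τ) (nAt y hy τ) (cAt x hx σ), mul_assoc (nAt x hx τ * nAt y hy τ)]
    have h2 : (cAt y hy σ)ᴴ * nAt y hy τ * (nAt x hx τ * cAt x hx σ) =
        nAt x hx τ * nAt y hy τ * ((cAt y hy σ)ᴴ * cAt x hx σ) := by
      rw [← nAt_mul_cAt_conjTranspose hστ y y hy hy, mul_assoc (nAt y hy τ) ((cAt y hy σ)ᴴ),
        ← mul_assoc ((cAt y hy σ)ᴴ) (nAt x hx τ) (cAt x hx σ), ← nAt_mul_cAt_conjTranspose hστ x y hx hy,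
        mul_assoc (nAt x hx τ) ((cAt y hy σ)ᴴ) (cAt x hx σ), ← mul_assoc (nAt y hy τ) (nAt x hx τ),
        nAt_comm y x hy hx]
    rw [h1, h2, ← mul_add, hcc]
    split_ifs with h
    · subst h; rw [mul_one, nAt_mul_self]
    · rw [mul_zero]

/-- Isotony: `Γ(incl) A_j(x) = A_j(x)`. -/
theorem fermionEmbed_incl_letterOp {Λ' : Finset (Site d)} (h : Λ ⊆ Λ') (j : Fin 2) (x : Site d) (hx : x ∈ Λ)
    (σ τ : Fin 2) : fermionEmbed (PolySite.incl h) (letterOp j x hx σ τ) = letterOp j x (h hx) σ τ := by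
  fin_cases j
  · simp
  · simp [nAt, fermionEmbed_numberOp]

/-- Translations: `Γ(τ_v) A_j(x) = A_j(x + v)`. -/
theorem fermionEmbed_shiftEmb_letterOp (v : Site d) (j : Fin 2) (x : Site d) (hx : x ∈ Λ) (σ τ : Fin 2) :
    fermionEmbed (PolySite.shiftEmb v Λ) (letterOp j x hx σ τ) =
      letterOp j (x + v) (PolySite.add_mem_shiftSet v hx) σ τ := by
  fin_cases j
  · simp
  · simp [nAt, fermionEmbed_numberOp]

/-- Isotony for the table: `Γ(incl) K_{jl}(x) = K_{jl}(x)`. -/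
theorem fermionEmbed_incl_letterGram {Λ' : Finset (Site d)} (h : Λ ⊆ Λ') (j l : Fin 2) (x : Site d)
    (hx : x ∈ Λ) (τ : Fin 2) : fermionEmbed (PolySite.incl h) (letterGram j l x hx τ) = letterGram j l x (h hx) τ := by
  unfold letterGram
  split_ifs
  · exact map_one _
  · simp [nAt, fermionEmbed_numberOp]

end Letters

/-! ### §3. Smeared letters and the Gram (anticommutator) identity -/

section Smear

variable {Λ : Finset (Site d)} {ι : Type*} [Fintype ι]

/-- **The smeared letter** `B(g) = Σ_i Σ_j g_{ij} A_j(x_i)` of a finite family of sites `x_i ∈ Λ` with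
coefficients `g_{ij} ∈ ℂ` (written as one sum over the index pairs `(i, j)`). -/
def smearedLetter (x : ι → Site d) (hx : ∀ i, x i ∈ Λ) (σ τ : Fin 2) (g : ι → Fin 2 → ℂ) : FermionOp Λ :=
  ∑ p : ι × Fin 2, g p.1 p.2 • letterOp p.2 (x p.1) (hx p.1) σ τ

/-- `B(g)` as a double sum. -/
theorem smearedLetter_eq_sum_sum (x : ι → Site d) (hx : ∀ i, x i ∈ Λ) (σ τ : Fin 2) (g : ι → Fin 2 → ℂ) :
    smearedLetter x hx σ τ g = ∑ i, ∑ j, g i j • letterOp j (x i) (hx i) σ τ := by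
  rw [smearedLetter, Fintype.sum_prod_type]

/-- `B(g)† = Σ ḡ_{ij} A_j(x_i)†`. -/
theorem smearedLetter_conjTranspose (x : ι → Site d) (hx : ∀ i, x i ∈ Λ) (σ τ : Fin 2) (g : ι → Fin 2 → ℂ) :
    (smearedLetter x hx σ τ g)ᴴ = ∑ p : ι × Fin 2, star (g p.1 p.2) • (letterOp p.2 (x p.1) (hx p.1) σ τ)ᴴ := by
  simp [smearedLetter, Matrix.conjTranspose_sum, Matrix.conjTranspose_smul]

/-- **The Gram identity for smeared letters** (distinct sites): `B B† + B† B = Σ_i Σ_{j,l} g_{ij} ḡ_{il} K_{jl}(x_i)`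
— the two-letter generalisation of Bratteli–Robinson II (5.2.12), from the four CAR identities
`{A_j(x), A_l(y)†} = δ_{xy} K_{jl}(x)`. -/
theorem smearedLetter_mul_conjTranspose_add {σ τ : Fin 2} (hστ : σ ≠ τ) {x : ι → Site d}
    (hxi : Function.Injective x) (hx : ∀ i, x i ∈ Λ) (g : ι → Fin 2 → ℂ) :
    smearedLetter x hx σ τ g * (smearedLetter x hx σ τ g)ᴴ + (smearedLetter x hx σ τ g)ᴴ * smearedLetter x hx σ τ g =
      ∑ i, ∑ j : Fin 2, ∑ l : Fin 2, (g i j * star (g i l)) • letterGram j l (x i) (hx i) τ := by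
  classical
  rw [smearedLetter_conjTranspose, smearedLetter]
  -- expand both products as double sums over pairs `(p, q)`
  have h1 : (∑ p : ι × Fin 2, g p.1 p.2 • letterOp p.2 (x p.1) (hx p.1) σ τ) *
      (∑ q : ι × Fin 2, star (g q.1 q.2) • (letterOp q.2 (x q.1) (hx q.1) σ τ)ᴴ) =
      ∑ p : ι × Fin 2, ∑ q : ι × Fin 2, (g p.1 p.2 * star (g q.1 q.2)) •
        (letterOp p.2 (x p.1) (hx p.1) σ τ * (letterOp q.2 (x q.1) (hx q.1) σ τ)ᴴ) := by
    rw [Finset.sum_mul]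
    refine Finset.sum_congr rfl fun p _ => ?_
    rw [Finset.mul_sum]
    refine Finset.sum_congr rfl fun q _ => ?_
    rw [Matrix.smul_mul, Matrix.mul_smul, smul_smul]
  have h2 : (∑ q : ι × Fin 2, star (g q.1 q.2) • (letterOp q.2 (x q.1) (hx q.1) σ τ)ᴴ) *
      (∑ p : ι × Fin 2, g p.1 p.2 • letterOp p.2 (x p.1) (hx p.1) σ τ) =
      ∑ p : ι × Fin 2, ∑ q : ι × Fin 2, (g p.1 p.2 * star (g q.1 q.2)) •
        ((letterOp q.2 (x q.1) (hx q.1) σ τ)ᴴ * letterOp p.2 (x p.1) (hx p.1) σ τ) := by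
    rw [Finset.sum_mul, Finset.sum_comm]
    refine Finset.sum_congr rfl fun p _ => ?_
    rw [Finset.mul_sum]
    refine Finset.sum_congr rfl fun q _ => ?_
    rw [Matrix.smul_mul, Matrix.mul_smul, smul_smul, mul_comm]
  rw [h1, h2, ← Finset.sum_add_distrib]
  simp_rw [← Finset.sum_add_distrib, ← smul_add]
  -- the letter CAR, site-injective
  have hCAR : ∀ p q : ι × Fin 2, letterOp p.2 (x p.1) (hx p.1) σ τ * (letterOp q.2 (x q.1) (hx q.1) σ τ)ᴴ +
      (letterOp q.2 (x q.1) (hx q.1) σ τ)ᴴ * letterOp p.2 (x p.1) (hx p.1) σ τ =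
      if p.1 = q.1 then letterGram p.2 q.2 (x p.1) (hx p.1) τ else 0 := by
    intro p q
    rw [letterOp_mul_conjTranspose_add hστ]
    by_cases hpq : p.1 = q.1
    · rw [if_pos (congrArg x hpq), if_pos hpq]
    · rw [if_neg (fun h => hpq (hxi h)), if_neg hpq]
  simp_rw [hCAR, smul_ite, smul_zero]
  -- collapse the `q`-sum
  rw [Fintype.sum_prod_type]
  refine Finset.sum_congr rfl fun i _ => Finset.sum_congr rfl fun j _ => ?_
  rw [Fintype.sum_prod_type, Finset.sum_comm]
  refine Finset.sum_congr rfl fun l _ => ?_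
  simp only [Finset.sum_ite_eq, Finset.mem_univ, if_true]

end Smear

end Summit.Ventures.CertifiedManyBodySolver.Transport

end
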